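import Summits.NavierStokesRegularity.FluidComputer.LerayFrontClock
import Summits.NavierStokesRegularity.FluidComputer.LeraySupClock
import Summits.NavierStokesRegularity.FluidComputer.LerayDeadline
import HarnessLib

/-!
# Fluid computer — the TIME FACE of the level dictionary, assembled (L19–L23 in one statement)

HONEST FRAMING (cell `pub-fluidc`, verbatim): *low prior, high value-of-information experiment on Tao's
machine paradigm; NOT a claim that NS blows up.* Theorem side of the cell; nothing here is evidence of blow-up.

One statement for the cell's paper (OUTLINE §4, the dictionary's time rows), with ONE absolute constant, collecting
what the four modules `LerayClock` (L19), `LerayFrontClock` (L20), `LeraySupClock` (L21–L22) and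
`LerayDeadline` (L23) prove about the CLOCK of a realised blow-up: for every maximal smooth solution `(u, p)` of
the unforced Navier–Stokes system on `ℝ³ × [0, T)` (`ν > 0`, Leray–Hopf from `u 0`, no smooth extension past `T`)
and every instant `t` before `T` —

* (D) DEADLINE (`t ∈ [0, T)`): `4 c ν⁵ (T − t) ≤ ‖u(t)‖₂⁴` — blow-up within `‖u(t)‖₂⁴/(4cν⁵)` of every instant;
* (C) COUNTDOWN (`t ∈ (0, T)`): `c ν³ ≤ (∫|∇u(t)|²)² (T − t)` — not sooner than `c ν³/Z(t)²`;
* (P) PRODUCT: `2 c ν⁴ ≤ ‖u(t)‖₂² ∫|∇u(t)|²` — never globally small;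
* (S) SUP CLOCK: `c √ν/√(T − t) ≤ ‖u(t)‖_∞`, and (B) in block-sup currency `≤ ∑_j ‖Δ̇_j u(t)‖_∞`;
* (E) ENSTROPHY-FRONT COUNTDOWN: for every level `q`, if `∑_{n≥0} 4^{q+n}‖Δ̇_{q+n}u(t)‖₂² ≤ 8·4^q‖u(0)‖₂²` then
  `c ν³ ≤ 9216 C_b⁴ 16^q ‖u(0)‖₂⁴ (T − t)`;
* (A) AMPLITUDE-FRONT COUNTDOWN: for every level `J`, if `∑_{n≥0} ‖Δ̇_{J+n}u(t)‖_∞ ≤ C_∞ G ‖u(0)‖₂ 2^{3(J−1)/2}`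
  then `c² ν ≤ 4 (C_∞ G ‖u(0)‖₂ 2^{3(J−1)/2})² (T − t)`.

In the machine's words: the hand-off clock of a realised blow-up ACCELERATES GEOMETRICALLY — each level the front
has not yet passed certifies time (factor `8` per level in amplitude, `16` in enstrophy), the whole run must fit
inside Leray's window, and the flow is never globally small. The single constant is the minimum of the modules'
constants (every clause is monotone in it). HONEST SIZE NOTE: `c`, `C_b`, `C_∞` inexplicit; read against words,
never against a certified atlas number. Necessity only. 0 sorry; no new definitions, no named facts.

## References

* J. Leray, Acta Math. 63 (1934) 193–248, §19–§20, §34. [Leray1934]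
* J. C. Robinson, J. L. Rodrigo, W. Sadowski, *The Three-Dimensional Navier–Stokes Equations*, CUP 2016,
  Lemma 6.11. [RobinsonRodrigoSadowski2016]
* H. Bahouri, J.-Y. Chemin, R. Danchin, *Fourier Analysis and Nonlinear PDE*, Springer 2011, Lemma 2.1,
  Prop. 2.12. [BahouriCheminDanchin2011]
-/

noncomputable section

open MeasureTheory Set Function Filter Topology Metric
open scoped ENNReal NNReal RealInnerProductSpace
open Literature.Analysis.FluidPDE Literature.Analysis.FunctionSpaces

namespace Summit.NavierStokesRegularity.FluidComputer.LerayTimeFace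

/-- **THE TIME FACE OF THE LEVEL DICTIONARY (assembled, one constant).** There is an absolute `c > 0` such that
for every `ν > 0`, `T > 0` and every maximal smooth solution `(u, p)` of the unforced Navier–Stokes system on
`ℝ³ × [0, T)` which is Leray–Hopf from `u 0`, with `Z(t) = ∫|∇u(t)|²`, `s_j(t) = ‖Δ̇_j u(t)‖_∞`,
`a_j(t) = ‖Δ̇_j u(t)‖₂`, `K = lpBounds (Fin 3)` (`C_b = K.Cb`, `C_∞ = K.Cinf`), `G = LPBounds.geomDim (Fin 3)`:
(D) for every `t ∈ [0, T)`, `4 c ν⁵ (T − t) ≤ ‖u(t)‖₂⁴` (DEADLINE, `LerayDeadline.deadline`); and for every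
`t ∈ (0, T)`: (C) `c ν³ ≤ Z(t)² (T − t)` (COUNTDOWN, `LerayClock.enstrophy_clock`); (P) `2 c ν⁴ ≤ ‖u(t)‖₂² Z(t)`
(`LerayDeadline.energy_enstrophy_product_ge`); (S) `c √ν/√(T − t) ≤ ‖u(t)‖_∞` (`LeraySupClock.supNorm_clock`);
(B) `c √ν/√(T − t) ≤ ∑_j s_j(t)` (`LeraySupClock.blockSup_sum_clock`); (E) for every `q : ℕ`, if
`∑_n 4^{q+n} a_{q+n}(t)² ≤ 8·4^q‖u(0)‖₂²` then `c ν³ ≤ 9216 C_b⁴ 16^q ‖u(0)‖₂⁴ (T − t)`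
(`LerayFrontClock.countdown`); (A) for every `J : ℤ`, if `∑_n s_{J+n}(t) ≤ C_∞ ‖u(0)‖₂ 2^{3(J−1)/2} G` then
`c² ν ≤ 4 (C_∞ G ‖u(0)‖₂ 2^{3(J−1)/2})² (T − t)` (`LeraySupClock.supCountdown`). The constant is the minimum of
the five modules' constants. [cite: Leray1934, §19–§20 and §34] [cite: RobinsonRodrigoSadowski2016, Lemma 6.11]
[cite: BahouriCheminDanchin2011, Lemma 2.1 and Prop. 2.12] -/
theorem time_face :
    ∃ c : ℝ, 0 < c ∧ ∀ (ν T : ℝ), 0 < ν → 0 < T →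
      ∀ (u : ℝ → EuclideanSpace ℝ (Fin 3) → EuclideanSpace ℝ (Fin 3)) (p : ℝ → EuclideanSpace ℝ (Fin 3) → ℝ),
      IsMaximalSmoothSolution ν 0 u p T → IsLerayHopfOn T ν 0 (u 0) u →
      (∀ t ∈ Ico 0 T, 4 * c * ν ^ 5 * (T - t) ≤ (eLpNorm (u t) 2 volume).toReal ^ 4) ∧
      ∀ t ∈ Ioo 0 T,
        c * ν ^ 3 ≤ (∫⁻ x, ENNReal.ofReal (frobeniusNormSq (fderiv ℝ (u t) x))).toReal ^ 2 * (T - t) ∧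
        2 * c * ν ^ 4 ≤ (eLpNorm (u t) 2 volume).toReal ^ 2 *
          (∫⁻ x, ENNReal.ofReal (frobeniusNormSq (fderiv ℝ (u t) x))).toReal ∧
        ENNReal.ofReal (c * Real.sqrt ν / Real.sqrt (T - t)) ≤ eLpNorm (u t) ∞ volume ∧
        ENNReal.ofReal (c * Real.sqrt ν / Real.sqrt (T - t)) ≤ ∑' j : ℤ, blockSup (u t) j ∧
        (∀ q : ℕ,
          (∑' n : ℕ, (2 : ℝ≥0∞) ^ (2 * (q + n)) * blockL2 (u t) ((q + n : ℕ) : ℤ) ^ 2) ≤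
            8 * (2 : ℝ≥0∞) ^ (2 * q) * eLpNorm (u 0) 2 volume ^ 2 →
          c * ν ^ 3 ≤ 9216 * ((lpBounds (Fin 3)).Cb : ℝ) ^ 4 * (16 : ℝ) ^ q *
            (eLpNorm (u 0) 2 volume).toReal ^ 4 * (T - t)) ∧
        (∀ J : ℤ,
          (∑' n : ℕ, blockSup (u t) (J + n)) ≤
            ((lpBounds (Fin 3)).Cinf : ℝ≥0∞) * eLpNorm (u 0) 2 volume *
              (2 : ℝ≥0∞) ^ (((J - 1 : ℤ) : ℝ) * Fintype.card (Fin 3) * 2⁻¹) * LPBounds.geomDim (Fin 3) →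
          c ^ 2 * ν ≤ 4 * (((lpBounds (Fin 3)).Cinf : ℝ) * (LPBounds.geomDim (Fin 3)).toReal *
            (eLpNorm (u 0) 2 volume).toReal * (2 : ℝ) ^ (((J - 1 : ℤ) : ℝ) * Fintype.card (Fin 3) * 2⁻¹)) ^ 2 *
            (T - t)) := by
  obtain ⟨c₁, hc₁, H₁⟩ := LerayDeadline.countdown_and_deadline
  obtain ⟨c₂, hc₂, H₂⟩ := LerayDeadline.energy_enstrophy_product_ge
  obtain ⟨c₃, hc₃, H₃⟩ := LeraySupClock.supNorm_clock
  obtain ⟨c₄, hc₄, H₄⟩ := LeraySupClock.blockSup_sum_clock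
  obtain ⟨c₅, hc₅, H₅⟩ := LerayFrontClock.countdown
  obtain ⟨c₆, hc₆, H₆⟩ := LeraySupClock.supCountdown
  set c : ℝ := min (min (min (min (min c₁ c₂) c₃) c₄) c₅) c₆ with hc
  have h6 : c ≤ c₆ := min_le_right _ _
  have h5 : c ≤ c₅ := (min_le_left _ _).trans (min_le_right _ _)
  have h4 : c ≤ c₄ := ((min_le_left _ _).trans (min_le_left _ _)).trans (min_le_right _ _)
  have h3 : c ≤ c₃ := (((min_le_left _ _).trans (min_le_left _ _)).trans (min_le_left _ _)).trans (min_le_right _ _)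
  have h12 : c ≤ min c₁ c₂ :=
    (((min_le_left _ _).trans (min_le_left _ _)).trans (min_le_left _ _)).trans (min_le_left _ _)
  have h1 : c ≤ c₁ := h12.trans (min_le_left _ _)
  have h2 : c ≤ c₂ := h12.trans (min_le_right _ _)
  have hc0 : 0 < c := by
    simp only [hc, lt_min_iff]
    exact ⟨⟨⟨⟨⟨hc₁, hc₂⟩, hc₃⟩, hc₄⟩, hc₅⟩, hc₆⟩
  refine ⟨c, hc0, fun ν T hν hT u p hmax hLH => ⟨fun t ht => ?_, fun t ht => ⟨?_, ?_, ?_, ?_, ?_, ?_⟩⟩⟩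
  · -- (D)
    have h := (H₁ ν T hν hT u p hmax hLH).2 t ht
    have hTt : 0 ≤ T - t := (sub_pos.2 ht.2).le
    calc 4 * c * ν ^ 5 * (T - t) ≤ 4 * c₁ * ν ^ 5 * (T - t) := by gcongr
      _ ≤ _ := h
  · -- (C)
    have h := (H₁ ν T hν hT u p hmax hLH).1 t ht
    have hTt : 0 ≤ T - t := (sub_pos.2 ht.2).le
    calc c * ν ^ 3 ≤ c₁ * ν ^ 3 := by gcongr
      _ ≤ _ := h
  · -- (P)
    have h := H₂ ν T hν hT u p hmax hLH t ht
    calc 2 * c * ν ^ 4 ≤ 2 * c₂ * ν ^ 4 := by gcongr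
      _ ≤ _ := h
  · -- (S)
    have h := H₃ ν T hν hT u p hmax hLH t ht
    refine (ENNReal.ofReal_le_ofReal ?_).trans h
    have hsq : 0 < Real.sqrt (T - t) := Real.sqrt_pos.2 (sub_pos.2 ht.2)
    exact div_le_div_of_nonneg_right (mul_le_mul_of_nonneg_right h3 (Real.sqrt_nonneg ν)) hsq.le
  · -- (B)
    have h := H₄ ν T hν hT u p hmax hLH t ht
    refine (ENNReal.ofReal_le_ofReal ?_).trans h
    have hsq : 0 < Real.sqrt (T - t) := Real.sqrt_pos.2 (sub_pos.2 ht.2)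
    exact div_le_div_of_nonneg_right (mul_le_mul_of_nonneg_right h4 (Real.sqrt_nonneg ν)) hsq.le
  · -- (E)
    intro q hq
    have h := H₅ ν T hν hT u p hmax hLH t ht q hq
    calc c * ν ^ 3 ≤ c₅ * ν ^ 3 := by gcongr
      _ ≤ _ := h
  · -- (A)
    intro J hJ
    have h := H₆ ν T hν hT u p hmax hLH t ht J hJ
    calc c ^ 2 * ν ≤ c₆ ^ 2 * ν := by
          have : c ^ 2 ≤ c₆ ^ 2 := pow_le_pow_left₀ hc0.le h6 2
          exact mul_le_mul_of_nonneg_right this hν.le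
      _ ≤ _ := h

/-! ## A second scale-invariant necessity: maximum speed × energy -/

/-- **THE AMPLITUDE–ENERGY PRODUCT NEVER DROPS BELOW `c' ν³`.** There is an absolute `c' > 0` such that along
every maximal smooth Leray–Hopf solution of the unforced system on `ℝ³ × [0, T)` (`ν > 0`), at EVERY `t ∈ (0, T)`
with `‖u(t)‖_∞ < ∞`: `c' ν³ ≤ ‖u(t)‖_∞ · ‖u(t)‖₂²` — the scale-invariant product of maximum speed and energy (which
dominates `‖u(t)‖₃³`) never becomes small along a realised blow-up. Sup clock × deadline from `time_face`:
`c²ν/‖u(t)‖_∞² ≤ T − t ≤ ‖u(t)‖₂⁴/(4cν⁵)`, hence `4c³ν⁶ ≤ ‖u(t)‖_∞² ‖u(t)‖₂⁴`; `c' = 2c√c`.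
[cite: Leray1934, §19 (3.9) and §34] -/
theorem amplitude_energy_product_ge :
    ∃ c' : ℝ, 0 < c' ∧ ∀ (ν T : ℝ), 0 < ν → 0 < T →
      ∀ (u : ℝ → EuclideanSpace ℝ (Fin 3) → EuclideanSpace ℝ (Fin 3)) (p : ℝ → EuclideanSpace ℝ (Fin 3) → ℝ),
      IsMaximalSmoothSolution ν 0 u p T → IsLerayHopfOn T ν 0 (u 0) u →
      ∀ t ∈ Ioo 0 T, eLpNorm (u t) ∞ volume ≠ ⊤ →
        c' * ν ^ 3 ≤ (eLpNorm (u t) ∞ volume).toReal * (eLpNorm (u t) 2 volume).toReal ^ 2 := by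
  obtain ⟨c, hc, H⟩ := time_face
  refine ⟨2 * c * Real.sqrt c, by positivity, fun ν T hν hT u p hmax hLH t ht htop => ?_⟩
  obtain ⟨hD, hrest⟩ := H ν T hν hT u p hmax hLH
  obtain ⟨-, -, hS, -, -, -⟩ := hrest t ht
  have hdead := hD t ⟨ht.1.le, ht.2⟩
  set V : ℝ := (eLpNorm (u t) ∞ volume).toReal with hV
  set E : ℝ := (eLpNorm (u t) 2 volume).toReal with hE
  have hV0 : 0 ≤ V := ENNReal.toReal_nonneg
  have hE0 : 0 ≤ E := ENNReal.toReal_nonneg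
  have hTt : 0 < T - t := sub_pos.2 ht.2
  -- the sup clock in real form: `c √ν / √(T - t) ≤ V`, hence `c² ν ≤ V² (T - t)`
  have hS' : c * Real.sqrt ν / Real.sqrt (T - t) ≤ V := by
    have h := ENNReal.toReal_mono htop hS
    rwa [ENNReal.toReal_ofReal (by positivity)] at h
  have hsq : 0 < Real.sqrt (T - t) := Real.sqrt_pos.2 hTt
  have h1 : c * Real.sqrt ν ≤ V * Real.sqrt (T - t) := (div_le_iff₀ hsq).1 hS'
  have h2 : (c * Real.sqrt ν) ^ 2 ≤ (V * Real.sqrt (T - t)) ^ 2 := pow_le_pow_left₀ (by positivity) h1 2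
  rw [mul_pow, Real.sq_sqrt hν.le, mul_pow, Real.sq_sqrt hTt.le] at h2
  -- `c² ν · 4 c ν⁵ (T - t) ≤ V² (T - t) · E⁴`, cancel `T - t`, take the square root
  have h3 : (2 * c * Real.sqrt c * ν ^ 3) ^ 2 * (T - t) ≤ (V * E ^ 2) ^ 2 * (T - t) := by
    have hcc : Real.sqrt c ^ 2 = c := Real.sq_sqrt hc.le
    have h4 : c ^ 2 * ν * (4 * c * ν ^ 5 * (T - t)) ≤ V ^ 2 * (T - t) * E ^ 4 :=
      mul_le_mul h2 hdead (by positivity) (by positivity)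
    calc (2 * c * Real.sqrt c * ν ^ 3) ^ 2 * (T - t) = c ^ 2 * ν * (4 * c * ν ^ 5 * (T - t)) := by
          rw [show (2 * c * Real.sqrt c * ν ^ 3) ^ 2 = 4 * c ^ 2 * Real.sqrt c ^ 2 * ν ^ 6 by ring, hcc]
          ring
      _ ≤ V ^ 2 * (T - t) * E ^ 4 := h4
      _ = (V * E ^ 2) ^ 2 * (T - t) := by ring
  have h5 : (2 * c * Real.sqrt c * ν ^ 3) ^ 2 ≤ (V * E ^ 2) ^ 2 := le_of_mul_le_mul_right h3 hTt
  have h6 := (pow_le_pow_iff_left₀ (by positivity) (by positivity) two_ne_zero).1 h5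
  linarith [h6]

end Summit.NavierStokesRegularity.FluidComputer.LerayTimeFace

end
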